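import Summits.CriticalPhenomena.Ising3DConformalLimit.Theses.ThresholdDilation
import Summits.CriticalPhenomena.Ising3DConformalLimit.Theses.HyperoctahedralRP
import Summits.CriticalPhenomena.Ising3DConformalLimit.Theorems.MoebiusLimitExists.Negative.ScaleRedundant
import Summits.CriticalPhenomena.Ising3DConformalLimit.Theorems.MoebiusLimitExists.Negative.FreeTranslations
import Summits.CriticalPhenomena.Ising3DConformalLimit.Theorems.HyperoctahedralRPLimitRotationInvariant
import Summits.CriticalPhenomena.Ising3DConformalLimit.Theorems.HyperoctahedralRPHRP2Rigidity
import Summits.CriticalPhenomena.Ising3DConformalLimit.Theorems.MoebiusLimitOfTwoPointLaw.Negative.CanonicalForm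
import Summits.CriticalPhenomena.Ising3DConformalLimit.Theorems.ThresholdDilationNondegeneracyOfDoubling
import Summits.CriticalPhenomena.Ising3DConformalLimit.Theorems.ThresholdDilationEtaOfDyadicLaw
import Literature.Probability.LatticeModels.HighDimPointwiseTriviality
import HarnessLib

/-!
# Line `calibrated-existence-split` for crux `ThresholdDilation.ConformalLimitOfDyadicLaw`
# (item stmt-CriticalPhenomena-6324) — crux-strategist skeleton (= the BC2 redirect, as a line)

Crux (by name): `Theses.ThresholdDilation.ConformalLimitOfDyadicLaw` = `DyadicScalingLaw → Ising3DConformalLimit`.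

Lever: CALIBRATE the renormalisation on the axis, `ρ_D(δ) := ⟨σ₀σ_{⌊1/δ⌋e₀}⟩_{β_c}^{-1/2}` (the rescaled pair
correlator at `(0,e₀)` is then identically `1`), so that the dyadic law `D` does real work —
`nondegenerate_of_dyadicLaw` (PROVED below): under `D` EVERY pointwise limit under `ρ_D` is non-degenerate
(calibration + all-scale doubling from `EtaOfDyadicLaw`, item 6326 proved + `NondegeneracyOfDoubling`,
item 6327 proved). What remains of the conjunct then splits into four registered stubs:

* `stub_twoPointLimit` (XL, the open core): `D →` the rescaled TWO-point function under `ρ_D` converges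
  locally uniformly on non-coincident pairs (`D` gives two-sided local bounds uniformly in `δ` and dyadic
  scale covariance of subsequential limits; missing: off-axis ratio regularity = asymptotic equicontinuity,
  and uniqueness of subsequential limits);
* `stub_allOrders` (L/XL, open): two-point convergence under `ρ_D` ⇒ convergence at all orders under `ρ_D`
  (sizes are Gaussian-dominated; convergence of the `2n`-point functions is a further step);
* `stub_inversionUpgrade` = item stmt-CriticalPhenomena-1982 `HyperoctahedralRP.InversionUpgradeNormalised` BY
  NAME (shared crux; live line `free-endpoint-gaussian-closure`, `Cruxes/InversionUpgradeNormalised`);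
* `stub_nonGaussian` = item stmt-CriticalPhenomena-0636 `HyperoctahedralRP.IsingEuclidUpgradeR4NonGaussian`
  BY NAME (shared crux; lines under `Cruxes/IsingEuclidUpgradeR4NonGaussian`).

Composition `ConformalLimitOfDyadicLaw_of` (kernel-checked, no `sorry` outside the stubs): stubs 1–2 and the
proved non-degeneracy give a non-degenerate limit `(ρ_D, S)`; normalise `S` off `NonCoincident`;
translations are free (`isTranslationInvariant_normalised_of_limit`), dilations are free with
`Δ ∈ [1/2,1]` (`exists_scaleCovariant_normalised`), `O(3)` is the tree theorem
`LimitRotationInvariant_of ∘ HRP2Rigidity_of` (items 1980/1979); stub 3 gives inversion with the same `Δ`,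
stub 4 gives `U₄ ≢ 0`; pack. (The same assembly with stubs 1–2 merged into the child
`LimitExistsOfDyadicLaw := D → WeylWindow.LimitExists` is `Cruxes/ConformalLimitOfDyadicLaw/Split.lean`.)
-/

noncomputable section

namespace Summit.CriticalPhenomena.Ising3DConformalLimit.Cruxes.ConformalLimitOfDyadicLaw.CalibratedExistenceSplit

open Literature.Probability.LatticeModels Filter Topology
open Summit.CriticalPhenomena.Ising3DConformalLimit.Theses
open Summit.CriticalPhenomena.Ising3DConformalLimit.MoebiusLimitExistsNegative

/-! ### The calibrated renormalisation and the dyadic law's teeth (proved) -/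

/-- The axis-calibrated ("dyadic") renormalisation `ρ_D(δ) = ⟨σ₀σ_{⌊1/δ⌋e₀}⟩_{β_c}^{-1/2}`. -/
def rhoD (δ : ℝ) : ℝ :=
  (criticalTwoPoint 3 (Pi.single (0 : Fin 3) ⌊1 / δ⌋)) ^ (-(1 / 2 : ℝ))

/-- `⟨σ₀σ_x⟩_{β_c} > 0` on `ℤ³` (Simon–Lieb lower bound off the origin, `= 1` at it). -/
theorem criticalTwoPoint_pos' (x : Site 3) : 0 < criticalTwoPoint 3 x := by
  by_cases hx : x = 0
  · rw [hx, criticalTwoPoint_zero']; exact one_pos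
  · obtain ⟨c, C, hc, hb⟩ := criticalTwoPoint_bounds_holds (d := 3) le_rfl
    exact lt_of_lt_of_le (mul_pos hc (Real.rpow_pos_of_pos (norm_pos_iff.2 hx) _)) (hb _ hx).1

/-- `ρ_D > 0` everywhere. -/
theorem rhoD_pos (δ : ℝ) : 0 < rhoD δ :=
  Real.rpow_pos_of_pos (criticalTwoPoint_pos' _) _

/-- Calibration: the rescaled pair correlator under `ρ_D` at `(0, e₀)` is identically `1`. -/
theorem rescaledCorrelator_rhoD_unitVec (δ : ℝ) :
    rescaledCorrelator (criticalCorr 3) rhoD 2 δ ![0, EuclideanSpace.single (0 : Fin 3) (1 : ℝ)] = 1 := by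
  rw [Summit.CriticalPhenomena.Ising3DConformalLimit.Theorems.MoebiusLimitOfTwoPointLaw.Negative.rescaledCorrelator_criticalCorr_unitVec]
  have hg := criticalTwoPoint_pos' (Pi.single (0 : Fin 3) ⌊1 / δ⌋)
  unfold rhoD
  rw [← Real.rpow_natCast, ← Real.rpow_mul hg.le]
  norm_num
  rw [Real.rpow_neg_one]
  exact inv_mul_cancel₀ (criticalTwoPoint_pos' _).ne'

/-- **The dyadic law's teeth (PROVED)**: under `DyadicScalingLaw` every pointwise limit under `ρ_D` is
non-degenerate — `S₂(0,e₀) = 1` by calibration, all-scale doubling from `EtaOfDyadicLaw` (item 6326,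
proved), transfer to every pair by `NondegeneracyOfDoubling` (item 6327, proved). -/
theorem nondegenerate_of_dyadicLaw (hD : ThresholdDilation.DyadicScalingLaw) (S : CorrFamily 3)
    (hlim : HasPointwiseScalingLimit (criticalCorr 3) rhoD S) : IsNondegenerateTwoPoint S := by
  have hdoub := (Summit.CriticalPhenomena.Ising3DConformalLimit.Theorems.ThresholdDilationEta.etaOfDyadicLaw_proof
    hD).2
  have hz : (![0, EuclideanSpace.single (0 : Fin 3) (1 : ℝ)] : Fin 2 → EuclideanSpace ℝ (Fin 3)) ∈
      NonCoincident 3 2 := zero_unitVec_mem_nonCoincident one_ne_zero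
  have h1 : Tendsto (fun δ => rescaledCorrelator (criticalCorr 3) rhoD 2 δ
      ![0, EuclideanSpace.single (0 : Fin 3) (1 : ℝ)]) (𝓝[>] (0 : ℝ))
      (𝓝 (S 2 ![0, EuclideanSpace.single (0 : Fin 3) (1 : ℝ)])) := (hlim 2).tendsto_at hz
  have hone : S 2 ![0, EuclideanSpace.single (0 : Fin 3) (1 : ℝ)] = 1 := by
    refine tendsto_nhds_unique h1 ?_
    simp only [rescaledCorrelator_rhoD_unitVec]
    exact tendsto_const_nhds
  exact Summit.CriticalPhenomena.Ising3DConformalLimit.ThresholdDilationNondegeneracyOfDoubling.nondegeneracyOfDoubling_proof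
    hdoub rhoD S (fun δ _ => rhoD_pos δ) hlim ⟨_, hz, by rw [hone]; exact one_pos⟩

/-! ### The four registered stubs -/

/-- STUB 1 (XL, open core): given the dyadic law, the rescaled two-point function under `ρ_D` converges
locally uniformly on non-coincident pairs. -/
theorem stub_twoPointLimit :
    ThresholdDilation.DyadicScalingLaw → ∃ S₂ : (Fin 2 → EuclideanSpace ℝ (Fin 3)) → ℝ,
      TendstoLocallyUniformlyOn (rescaledCorrelator (criticalCorr 3) rhoD 2) S₂ (𝓝[>] (0 : ℝ))
        (NonCoincident 3 2) := by
  sorry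

/-- STUB 2 (L/XL, open): two-point convergence under `ρ_D` upgrades to every order under the same `ρ_D`. -/
theorem stub_allOrders :
    (∃ S₂ : (Fin 2 → EuclideanSpace ℝ (Fin 3)) → ℝ,
      TendstoLocallyUniformlyOn (rescaledCorrelator (criticalCorr 3) rhoD 2) S₂ (𝓝[>] (0 : ℝ))
        (NonCoincident 3 2)) →
      ∃ S : CorrFamily 3, HasPointwiseScalingLimit (criticalCorr 3) rhoD S := by
  sorry

/-- STUB 3 = item stmt-CriticalPhenomena-1982 by name (shared crux: the inversion upgrade). -/
theorem stub_inversionUpgrade : HyperoctahedralRP.InversionUpgradeNormalised := by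
  sorry

/-- STUB 4 = item stmt-CriticalPhenomena-0636 by name (shared crux: non-Gaussianity in `d = 3`). -/
theorem stub_nonGaussian : HyperoctahedralRP.IsingEuclidUpgradeR4NonGaussian := by
  sorry

/-! ### Composition: the crux BY NAME -/

open Classical in
/-- **The crux from the four stub STATEMENTS** (no `sorry` here): `(ρ_D, S)` from stubs 1–2 is non-degenerate
by the dyadic law (proved); normalise; translations and dilations are free, `O(3)` is a theorem of the tree;
stub 3 gives inversion, stub 4 gives `U₄ ≢ 0`. -/
theorem crux_of_stubs
    (h₁ : ThresholdDilation.DyadicScalingLaw → ∃ S₂ : (Fin 2 → EuclideanSpace ℝ (Fin 3)) → ℝ,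
      TendstoLocallyUniformlyOn (rescaledCorrelator (criticalCorr 3) rhoD 2) S₂ (𝓝[>] (0 : ℝ))
        (NonCoincident 3 2))
    (h₂ : (∃ S₂ : (Fin 2 → EuclideanSpace ℝ (Fin 3)) → ℝ,
      TendstoLocallyUniformlyOn (rescaledCorrelator (criticalCorr 3) rhoD 2) S₂ (𝓝[>] (0 : ℝ))
        (NonCoincident 3 2)) →
      ∃ S : CorrFamily 3, HasPointwiseScalingLimit (criticalCorr 3) rhoD S)
    (h₃ : HyperoctahedralRP.InversionUpgradeNormalised)
    (h₄ : HyperoctahedralRP.IsingEuclidUpgradeR4NonGaussian) :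
    ThresholdDilation.DyadicScalingLaw → _root_.Ising3DConformalLimit := by
  -- (the crux `ConformalLimitOfDyadicLaw` unfolded one step, so that only `ConformalLimitOfDyadicLaw_of` below
  -- concludes the crux by name for the skeleton registry)
  intro hD
  obtain ⟨S, hlim⟩ := h₂ (h₁ hD)
  have hρ : ∀ δ ∈ Set.Ioc (0 : ℝ) 1, 0 < rhoD δ := fun δ _ => rhoD_pos δ
  have hnd : IsNondegenerateTwoPoint S := nondegenerate_of_dyadicLaw hD S hlim
  -- dilations are free, with the `ℤ³` window `Δ ∈ [1/2, 1]`
  obtain ⟨Δ, hwin, hsc'⟩ := exists_scaleCovariant_normalised hρ hlim hnd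
  have hlim' := normalised_hasLimit hlim
  have hnd' := normalised_nondeg hnd
  have hnorm' : ∀ (n : ℕ) (z : Fin n → EuclideanSpace ℝ (Fin 3)), z ∉ NonCoincident 3 n →
      (fun (n : ℕ) (x : Fin n → EuclideanSpace ℝ (Fin 3)) =>
        if x ∈ NonCoincident 3 n then S n x else 0) n z = 0 := fun n z hz => by
    simp only [if_neg hz]
  -- translations are free
  have htr' := isTranslationInvariant_normalised_of_limit hlim
  -- rotations: items 1980 and 1979 are theorems of the tree
  have hrot' : IsRotationInvariant (fun (n : ℕ) (x : Fin n → EuclideanSpace ℝ (Fin 3)) =>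
      if x ∈ NonCoincident 3 n then S n x else 0) :=
    Cruxes.LimitRotationInvariant.QuarterTurnLiouville.LimitRotationInvariant_of
      Cruxes.HRP2Rigidity.XRayMellin.HRP2Rigidity_of rhoD Δ _ hρ hlim' hnorm' hnd' htr' hsc'
  have hinv' := h₃ rhoD Δ _ hρ hlim' hnorm' hnd' ⟨htr', hrot'⟩ hsc'
  have hU' := h₄ rhoD _ hρ hlim' hnd'
  exact ⟨rhoD, Δ, _, hρ, by linarith [hwin.1], hlim', hnd', ⟨⟨htr', hrot'⟩, hsc', hinv'⟩, hU'⟩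

/-- **Registered composition**: the crux BY NAME from the four named stubs. -/
theorem ConformalLimitOfDyadicLaw_of : ThresholdDilation.ConformalLimitOfDyadicLaw :=
  crux_of_stubs stub_twoPointLimit stub_allOrders stub_inversionUpgrade stub_nonGaussian

end Summit.CriticalPhenomena.Ising3DConformalLimit.Cruxes.ConformalLimitOfDyadicLaw.CalibratedExistenceSplit

end
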